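import Mathlib.MeasureTheory.Constructions.BorelSpace.Order
import Mathlib.Analysis.InnerProductSpace.Continuous
import Literature.Analysis.FluidPDE.HardSphereFlowOrbits
import HarnessLib

/-!
# Measurability of the collision-by-collision hard-sphere flow

Third layer of the proof of Alexander's theorem on `T^d`
(`Kinetic.HardSphereFlow.nonempty_torus`, reduced in
`Literature.Analysis.FluidPDE.HardSphereFlowConstruction` to five named facts about the explicit
construction `Kinetic.Alexander.flow` / `Kinetic.Alexander.good`). This file discharges the
third fact, `Kinetic.Alexander.torusFlow_measurable`: the good set `Γ₀` is Borel and every time-`t`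
map `T^t` is Borel measurable (implicit in Cercignani–Illner–Pulvirenti 1994 App. 4.A–4.B and
Gallagher–Saint-Raymond–Texier 2013 §4.2, where `T^t` and `Γ₀` are integrated against). The
proof is elementary but not short, and is carried out for an arbitrary *regular*
(`Geometry.IsHardSphereRegular`) and *measurable* geometry, then specialised to the torus.

* `Kinetic.Geometry.IsMeasurable G`: the translation `(x, v) ↦ x + v` and the separation map
  `(x, y) ↦ x - y` are jointly measurable; instances `Euclidean.isMeasurable_geometry`,
  `Torus.isMeasurable_geometry`; measurability of positions, velocities, `freeFlight` (jointly in
  time and datum), `collidePair`, `flipVel`, and of the sets `IsIncoming` / `IsOutgoing`.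
* `Kinetic.Alexander.freeExitTime_eq_iInf_rat`: for a regular geometry the exit time
  `τ(z) = inf {t ≥ 0 | S_t z ∉ D}` is the infimum over *rational* exit times (the domain is closed
  and `t ↦ S_t z` is continuous), whence `measurable_freeExitTime`.
* `Kinetic.Alexander.stepMap`, `collisionStep_eq`, `measurable_collisionStep`: the collision step
  is a finite union (over the finitely many possible sets of incoming contact pairs) of measurable
  maps on measurable pieces; then `measurable_stateAfter`, `measurable_collisionInstant`.
* `Nat.sSup_eq_iff_of_lowerSet` (a supremum of a nonempty lower set of naturals is characterised
  by membership), `measurable_collisionCount`, `measurable_collisionCountBefore`,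
  `measurable_fwdFlow`, `measurable_fwdFlowLeft`, `measurable_flow`.
* `measurableSet_isSimpleIncoming`, `measurableSet_noTouch` (the "no grazing touch inside a free
  segment" condition is a countable intersection over rational windows, by compactness of
  `[a, b]` and continuity of the separation along free flight), `measurableSet_fwdGood`,
  `measurableSet_good`.
* `Kinetic.Alexander.torusFlow_measurable_holds : torusFlow_measurable` — the discharge.

## Mathlib / Literature reuse

`Measurable.iInf` over a countable index (`Mathlib.MeasureTheory.Constructions.BorelSpace.Order`),
`Measurable.inner`, `measurableSet_lt`, `measurable_pi_lambda`, `Measurable.piecewise`,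
`ENNReal.measurable_ofReal`, `Measurable.ennreal_tsum` are Mathlib's. The dynamics
(`freeExitTime`, `collisionStep`, `stateAfter`, `collisionInstant`, `collisionCount(Before)`,
`fwdFlow(Left)`, `flow`, `IsSimpleIncoming`, `FwdGood`, `good`) is
`HardSphereFlowConstruction`'s; regularity (`IsHardSphereRegular`, closedness of the domain,
continuity of free flight) is `HardSphereRegularGeometry`'s; the exit-time kit is
`HardSphereFlowOrbits`'.

## Design choices

* Measurability is proved from two structural hypotheses on the geometry (regular + measurable)
  rather than for the torus only, at no extra cost; both hold for `ℝ^d` and `T^d`.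
* `collisionStep` involves `Set.Nonempty.some`; measurability is obtained by splitting the phase
  space according to the (finitely many) possible values of the finite set `incomingPairs`, on
  each of which the step is a fixed `collidePair ∘ freeFlight τ(·)`.

## References

* C. Cercignani, R. Illner, M. Pulvirenti, *The Mathematical Theory of Dilute Gases*, Springer
  (1994), §4.2, App. 4.A–4.B.
* I. Gallagher, L. Saint-Raymond, B. Texier, *From Newton to Boltzmann*, EMS (2013), §4.1–4.2.
-/

open Set Filter Topology Function MeasureTheory
open scoped ENNReal InnerProductSpace

namespace Literature.Analysis.FluidPDE

noncomputable section

section Kinetic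

variable {d : Type*} [Fintype d] {X : Type*} {N : ℕ}

/-! ## Measurable geometries -/

/-- A geometry is *measurable* if its translation and separation maps are jointly measurable
(true for `ℝ^d` and `T^d`). [folklore] -/
structure Geometry.IsMeasurable [MeasurableSpace X] (G : Geometry d X) : Prop where
  /-- `(x, v) ↦ x + v` is measurable. -/
  measurable_translate : Measurable fun p : X × EuclideanSpace ℝ d => G.translate p.1 p.2
  /-- `(x, y) ↦ x - y` is measurable. -/
  measurable_sepVec : Measurable fun p : X × X => G.sepVec p.1 p.2

end Kinetic

/-- The Euclidean geometry is measurable. [folklore] -/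
theorem Euclidean.isMeasurable_geometry {d : Type*} [Fintype d] :
    (Euclidean.geometry d).IsMeasurable where
  measurable_translate := measurable_fst.add measurable_snd
  measurable_sepVec := Euclidean.measurable_geometry_sepVec

/-- The torus geometry is measurable. [folklore] -/
theorem Torus.isMeasurable_geometry {d : Type*} [Fintype d] :
    (Torus.geometry d).IsMeasurable where
  measurable_translate := by
    change Measurable fun p : UnitAddTorus d × EuclideanSpace ℝ d => p.1 + FunctionSpaces.Torus.proj p.2
    exact measurable_fst.add (FunctionSpaces.Torus.continuous_proj.measurable.comp measurable_snd)
  measurable_sepVec := Torus.measurable_geometry_sepVec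

section Kinetic

variable {d : Type*} [Fintype d] {X : Type*} {N : ℕ} [MeasurableSpace X] {G : Geometry d X} {ε : ℝ}

namespace Geometry.IsMeasurable

/-! ## Measurability of the static maps -/

omit [Fintype d] in
/-- The position of particle `i` is a measurable function of the configuration. [folklore] -/
theorem measurable_pos (i : Fin N) : Measurable fun z : Config N d X => (z i).1 :=
  (measurable_pi_apply i).fst

omit [Fintype d] in
/-- The velocity of particle `i` is a measurable function of the configuration. [folklore] -/
theorem measurable_vel (i : Fin N) : Measurable fun z : Config N d X => (z i).2 :=
  (measurable_pi_apply i).snd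

/-- The separation vector of a pair is a measurable function of the configuration. [folklore] -/
theorem measurable_sepVec_config (hG : G.IsMeasurable) (i j : Fin N) :
    Measurable fun z : Config N d X => G.sepVec (z i).1 (z j).1 :=
  hG.measurable_sepVec.comp ((measurable_pos i).prodMk (measurable_pos j))

/-- Free flight is jointly measurable in time and datum. [folklore] -/
theorem measurable_freeFlight₂ (hG : G.IsMeasurable) :
    Measurable fun p : ℝ × Config N d X => freeFlight G p.1 p.2 := by
  refine measurable_pi_lambda _ fun i => ?_
  have hx : Measurable fun p : ℝ × Config N d X => (p.2 i).1 := (measurable_pos i).comp measurable_snd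
  have hv : Measurable fun p : ℝ × Config N d X => (p.2 i).2 := (measurable_vel i).comp measurable_snd
  have hsmul : Measurable fun p : ℝ × Config N d X => p.1 • (p.2 i).2 :=
    continuous_smul.measurable.comp (measurable_fst.prodMk hv)
  exact (hG.measurable_translate.comp (hx.prodMk hsmul)).prodMk hv

/-- Each free-flight map is measurable. [folklore] -/
theorem measurable_freeFlight (hG : G.IsMeasurable) (t : ℝ) :
    Measurable (freeFlight (N := N) G t) :=
  hG.measurable_freeFlight₂.comp (measurable_const.prodMk measurable_id)

/-- The set of configurations in which the pair `(i, j)` is incoming is measurable. [folklore] -/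
theorem measurableSet_isIncoming (hG : G.IsMeasurable) (i j : Fin N) :
    MeasurableSet {z : Config N d X | IsIncoming G z i j} :=
  measurableSet_lt ((hG.measurable_sepVec_config i j).inner
    ((measurable_vel i).sub (measurable_vel j))) measurable_const

/-- The set of configurations in which the pair `(i, j)` is outgoing is measurable. [folklore] -/
theorem measurableSet_isOutgoing (hG : G.IsMeasurable) (i j : Fin N) :
    MeasurableSet {z : Config N d X | IsOutgoing G z i j} :=
  measurableSet_lt measurable_const ((hG.measurable_sepVec_config i j).inner
    ((measurable_vel i).sub (measurable_vel j)))

/-- The elastic collision of a fixed pair is a measurable self-map. [folklore] -/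
theorem measurable_collidePair (hG : G.IsMeasurable) (i j : Fin N) :
    Measurable (collidePair (N := N) G i j) := by
  have hn := hG.measurable_sepVec_config (N := N) i j
  have hvi := measurable_vel (N := N) (d := d) (X := X) i
  have hvj := measurable_vel (N := N) (d := d) (X := X) j
  have hc : Measurable fun z : Config N d X =>
      ⟪(z i).2 - (z j).2, G.sepVec (z i).1 (z j).1⟫_ℝ / ‖G.sepVec (z i).1 (z j).1‖ ^ 2 :=
    ((hvi.sub hvj).inner hn).div (hn.norm.pow_const 2)
  have hR1 : Measurable fun z : Config N d X =>
      (reflectVel (G.sepVec (z i).1 (z j).1) ((z i).2, (z j).2)).1 := hvi.sub (hc.smul hn)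
  have hR2 : Measurable fun z : Config N d X =>
      (reflectVel (G.sepVec (z i).1 (z j).1) ((z i).2, (z j).2)).2 := hvj.add (hc.smul hn)
  refine measurable_pi_lambda _ fun k => ?_
  by_cases hkj : k = j
  · subst hkj
    simp only [collidePair_apply_right]
    exact (measurable_pos k).prodMk hR2
  by_cases hki : k = i
  · subst hki
    simp only [collidePair_apply_left hkj]
    exact (measurable_pos k).prodMk hR1
  · simp only [collidePair_apply_of_ne hki hkj]
    exact measurable_pi_apply k

end Geometry.IsMeasurable

/-- The velocity flip is measurable. [folklore] -/
theorem measurable_flipVel : Measurable (flipVel : Config N d X → Config N d X) :=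
  measurable_pi_lambda _ fun i =>
    (Geometry.IsMeasurable.measurable_pos i).prodMk (Geometry.IsMeasurable.measurable_vel i).neg

namespace Alexander

/-! ## Measurability of the exit time -/

section ExitTime

variable [TopologicalSpace X]

omit [MeasurableSpace X] in
open Classical in
/-- **The exit time is an infimum over rational times** (regular geometry: the domain is closed
and free flight is continuous in time, so an exit at a real time is witnessed by rational times
just after it). [folklore] -/
theorem freeExitTime_eq_iInf_rat (hG : G.IsHardSphereRegular ε) (z : Config N d X) :
    freeExitTime G ε z = ⨅ q : ℚ, if 0 ≤ (q : ℝ) ∧ freeFlight G q z ∉ hardSphereDomain G N ε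
      then ENNReal.ofReal q else ∞ := by
  refine le_antisymm (le_iInf fun q => ?_) (le_sInf ?_)
  · split_ifs with h
    · exact freeExitTime_le_of_not_mem h.1 h.2
    · exact le_top
  · rintro t ⟨ht, hmem⟩
    refine ENNReal.le_of_forall_pos_le_add fun δ hδ _ => ?_
    have hopen : ∀ᶠ s in 𝓝 t.toReal, freeFlight G s z ∉ hardSphereDomain G N ε :=
      (hG.continuous_freeFlight z).continuousAt.eventually
        (hG.isClosed_hardSphereDomain.isOpen_compl.mem_nhds hmem)
    obtain ⟨η, hη, hball⟩ := Metric.eventually_nhds_iff.1 hopen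
    have hlt : t.toReal < min (t.toReal + η) (t.toReal + δ) :=
      lt_min (lt_add_of_pos_right _ hη) (lt_add_of_pos_right _ (by simpa using hδ))
    obtain ⟨q, htq, hq⟩ := exists_rat_btwn hlt
    have hq0 : 0 ≤ (q : ℝ) := ENNReal.toReal_nonneg.trans htq.le
    have hqmem : freeFlight G q z ∉ hardSphereDomain G N ε := by
      refine hball ?_
      rw [Real.dist_eq, abs_lt]
      constructor <;> linarith [lt_min_iff.1 hq]
    calc (⨅ q : ℚ, if 0 ≤ (q : ℝ) ∧ freeFlight G q z ∉ hardSphereDomain G N ε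
          then ENNReal.ofReal q else ∞) ≤ ENNReal.ofReal q := by
            refine (iInf_le _ q).trans ?_
            rw [if_pos ⟨hq0, hqmem⟩]
      _ ≤ ENNReal.ofReal (t.toReal + δ) := ENNReal.ofReal_le_ofReal (lt_min_iff.1 hq).2.le
      _ ≤ ENNReal.ofReal t.toReal + ENNReal.ofReal δ := ENNReal.ofReal_add_le
      _ = t + δ := by rw [ENNReal.ofReal_toReal ht, ENNReal.ofReal_coe_nnreal]

open Classical in
/-- **The exit time is measurable** (regular and measurable geometry). [folklore] -/
theorem measurable_freeExitTime (hG : G.IsHardSphereRegular ε) (hGm : G.IsMeasurable) :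
    Measurable (freeExitTime (N := N) G ε) := by
  have h : freeExitTime (N := N) G ε = fun z => ⨅ q : ℚ,
      if 0 ≤ (q : ℝ) ∧ freeFlight G q z ∉ hardSphereDomain G N ε then ENNReal.ofReal q else ∞ :=
    funext (freeExitTime_eq_iInf_rat hG)
  rw [h]
  refine Measurable.iInf fun q => Measurable.ite ?_ measurable_const measurable_const
  by_cases hq : 0 ≤ (q : ℝ)
  · simp only [hq, true_and]
    exact (hGm.measurable_freeFlight q) (measurableSet_hardSphereDomain G hGm.measurable_sepVec N ε).compl
  · simp only [hq, false_and, setOf_false, MeasurableSet.empty]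

end ExitTime

/-! ## Measurability of the collision step -/

open Classical in
/-- The choice made by the collision step, as a function of the *set* of incoming pairs: for a
set `S` of ordered pairs and a configuration `w`, collide the pair `S.some` if `S` is nonempty.
`collisionStep G ε z` is `stepMap G (incomingPairs G ε z') z'` at the exit configuration `z'`
(`collisionStep_eq`), which exhibits the collision step as a finite combination of measurable
maps. [folklore] -/
def stepMap (G : Geometry d X) (S : Set (Fin N × Fin N)) (w : Config N d X) : Config N d X :=
  if h : S.Nonempty then collidePair G h.some.1 h.some.2 w else w

omit [MeasurableSpace X] in
/-- The collision step through `stepMap`. [folklore] -/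
theorem collisionStep_eq (z : Config N d X) :
    collisionStep G ε z = if freeExitTime G ε z = ∞ then z else
      stepMap G (incomingPairs G ε (freeFlight G (freeExitTime G ε z).toReal z))
        (freeFlight G (freeExitTime G ε z).toReal z) := by
  unfold collisionStep stepMap
  congr

/-- For a fixed set of pairs, `stepMap G S` is measurable. [folklore] -/
theorem measurable_stepMap (hGm : G.IsMeasurable) (S : Set (Fin N × Fin N)) :
    Measurable (stepMap (N := N) G S) := by
  unfold stepMap
  split_ifs with h
  · exact hGm.measurable_collidePair _ _
  · exact measurable_id

/-- Membership of a fixed pair in `incomingPairs` is a measurable condition. [folklore] -/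
theorem measurableSet_mem_incomingPairs (hGm : G.IsMeasurable) (p : Fin N × Fin N) :
    MeasurableSet {w : Config N d X | p ∈ incomingPairs G ε w} := by
  simp only [mem_incomingPairs]
  refine measurableSet_setOf.2 (measurable_const.and ((measurableSet_setOf.1 ?_).and
    (measurableSet_setOf.1 (hGm.measurableSet_isIncoming p.1 p.2))))
  exact measurableSet_contactSet G hGm.measurable_sepVec N ε p.1 p.2

/-- `z ↦ stepMap G (incomingPairs G ε (w z)) (w z)` is measurable for measurable `w`: the set of
incoming pairs takes finitely many values on measurable level sets. [folklore] -/
theorem measurable_stepMap_incomingPairs (hGm : G.IsMeasurable) {w : Config N d X → Config N d X}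
    (hw : Measurable w) :
    Measurable fun z => stepMap G (incomingPairs G ε (w z)) (w z) := by
  letI : MeasurableSpace (Set (Fin N × Fin N)) := ⊤
  haveI : MeasurableSingletonClass (Set (Fin N × Fin N)) := ⟨fun _ => trivial⟩
  have hF : Measurable fun p : Set (Fin N × Fin N) × Config N d X => stepMap G p.1 p.2 :=
    measurable_from_prod_countable_right fun S => measurable_stepMap hGm S
  have hS : Measurable fun z => incomingPairs G ε (w z) := by
    refine measurable_to_countable' fun S => ?_
    have hset : (fun z => incomingPairs G ε (w z)) ⁻¹' {S} =
        ⋂ p : Fin N × Fin N, {z | p ∈ incomingPairs G ε (w z) ↔ p ∈ S} := by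
      ext z
      simp only [mem_preimage, mem_singleton_iff, mem_iInter, mem_setOf_eq, Set.ext_iff]
    rw [hset]
    refine MeasurableSet.iInter fun p => measurableSet_setOf.2 ?_
    exact (measurableSet_setOf.1 ((measurableSet_mem_incomingPairs hGm p).preimage hw)).iff
      measurable_const
  exact hF.comp (hS.prodMk hw)

section Step

variable [TopologicalSpace X]

/-- **The collision step is measurable** (regular and measurable geometry). [folklore] -/
theorem measurable_collisionStep (hG : G.IsHardSphereRegular ε) (hGm : G.IsMeasurable) :
    Measurable (collisionStep (N := N) G ε) := by
  have hτ := measurable_freeExitTime (N := N) hG hGm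
  have hz' : Measurable fun z : Config N d X => freeFlight G (freeExitTime G ε z).toReal z :=
    hGm.measurable_freeFlight₂.comp (hτ.ennreal_toReal.prodMk measurable_id)
  have h : collisionStep (N := N) G ε = fun z => if freeExitTime G ε z = ∞ then z else
      stepMap G (incomingPairs G ε (freeFlight G (freeExitTime G ε z).toReal z))
        (freeFlight G (freeExitTime G ε z).toReal z) := funext collisionStep_eq
  rw [h]
  exact Measurable.ite (hτ (measurableSet_singleton ∞)) measurable_id
    (measurable_stepMap_incomingPairs hGm hz')

/-- The `k`-th post-collisional state is a measurable function of the datum. [folklore] -/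
theorem measurable_stateAfter (hG : G.IsHardSphereRegular ε) (hGm : G.IsMeasurable) (k : ℕ) :
    Measurable fun z : Config N d X => stateAfter G ε z k :=
  (measurable_collisionStep hG hGm).iterate k

/-- The `k`-th collision instant is a measurable function of the datum. [folklore] -/
theorem measurable_collisionInstant (hG : G.IsHardSphereRegular ε) (hGm : G.IsMeasurable) (k : ℕ) :
    Measurable fun z : Config N d X => collisionInstant G ε z k := by
  induction k with
  | zero => simp only [collisionInstant_zero, measurable_const]
  | succ k ih =>
    simp only [collisionInstant_succ]
    exact ih.add ((measurable_freeExitTime hG hGm).comp (measurable_stateAfter hG hGm k))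

end Step

/-! ## Measurability of the collision counts and of the flow -/

/-- The supremum of a lower set of naturals containing `0`: it is `k` iff either `k` is the
largest element, or the set is everything and `k = 0` (Mathlib's junk value `sSup ℕ = 0`). [folklore] -/
theorem _root_.Nat.sSup_eq_iff_of_lowerSet {S : Set ℕ} (h0 : 0 ∈ S)
    (hS : ∀ m n, m ≤ n → n ∈ S → m ∈ S) (k : ℕ) :
    sSup S = k ↔ (k ∈ S ∧ k + 1 ∉ S) ∨ (k = 0 ∧ ∀ m, m ∈ S) := by
  by_cases hb : BddAbove S
  · have hne : S.Nonempty := ⟨0, h0⟩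
    have hmem : sSup S ∈ S := Nat.sSup_mem hne hb
    have hnot : sSup S + 1 ∉ S := fun h => Nat.lt_irrefl _ (Nat.lt_of_succ_le (le_csSup hb h))
    have hall : ¬∀ m, m ∈ S := fun h => by
      obtain ⟨B, hB⟩ := hb
      exact Nat.lt_irrefl B (Nat.lt_of_succ_le (hB (h (B + 1))))
    constructor
    · rintro rfl
      exact Or.inl ⟨hmem, hnot⟩
    · rintro (⟨hk, hk1⟩ | ⟨-, h⟩)
      · refine le_antisymm ?_ (le_csSup hb hk)
        by_contra hlt
        exact hk1 (hS _ _ (Nat.succ_le_of_lt (not_le.1 hlt)) hmem)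
      · exact (hall h).elim
  · have hall : ∀ m, m ∈ S := fun m => by
      by_contra hm
      exact hb ⟨m, fun n hn => le_of_lt (not_le.1 fun hmn => hm (hS _ _ hmn hn))⟩
    rw [Nat.sSup_of_not_bddAbove hb]
    constructor
    · rintro rfl
      exact Or.inr ⟨rfl, hall⟩
    · rintro (⟨-, hk1⟩ | ⟨rfl, -⟩)
      · exact (hk1 (hall _)).elim
      · rfl

section Flow

variable [TopologicalSpace X]

/-- The number of collisions in `[0, t]` is a measurable function of the datum. [folklore] -/
theorem measurable_collisionCount (hG : G.IsHardSphereRegular ε) (hGm : G.IsMeasurable) (t : ℝ) :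
    Measurable fun z : Config N d X => collisionCount G ε z t := by
  refine measurable_to_countable' fun k => ?_
  have hA : ∀ m, MeasurableSet {z : Config N d X | collisionInstant G ε z m ≤ ENNReal.ofReal t} :=
    fun m => measurableSet_le (measurable_collisionInstant hG hGm m) measurable_const
  have hset : (fun z : Config N d X => collisionCount G ε z t) ⁻¹' {k} =
      {z | (collisionInstant G ε z k ≤ ENNReal.ofReal t ∧
        ¬collisionInstant G ε z (k + 1) ≤ ENNReal.ofReal t) ∨
        (k = 0 ∧ ∀ m, collisionInstant G ε z m ≤ ENNReal.ofReal t)} := by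
    ext z
    simp only [mem_preimage, mem_singleton_iff, mem_setOf_eq]
    exact Nat.sSup_eq_iff_of_lowerSet (S := {m | collisionInstant G ε z m ≤ ENNReal.ofReal t})
      (by simp) (fun m n hmn hn => (monotone_collisionInstant z hmn).trans hn) k
  rw [hset]
  refine measurableSet_setOf.2 ((((measurableSet_setOf.1 (hA k)).and
    (measurableSet_setOf.1 (hA (k + 1))).not)).or (measurable_const.and
      (Measurable.forall fun m => measurableSet_setOf.1 (hA m))))

/-- The number of collisions in `[0, t)` is a measurable function of the datum. [folklore] -/
theorem measurable_collisionCountBefore (hG : G.IsHardSphereRegular ε) (hGm : G.IsMeasurable)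
    (t : ℝ) : Measurable fun z : Config N d X => collisionCountBefore G ε z t := by
  rcases le_or_gt t 0 with ht | ht
  · have h : (fun z : Config N d X => collisionCountBefore G ε z t) = fun _ => 0 := by
      funext z
      exact collisionCountBefore_eq_zero_of_le (by simp [ENNReal.ofReal_of_nonpos ht])
    rw [h]
    exact measurable_const
  refine measurable_to_countable' fun k => ?_
  have hA : ∀ m, MeasurableSet {z : Config N d X | collisionInstant G ε z m < ENNReal.ofReal t} :=
    fun m => measurableSet_lt (measurable_collisionInstant hG hGm m) measurable_const
  have hset : (fun z : Config N d X => collisionCountBefore G ε z t) ⁻¹' {k} =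
      {z | (collisionInstant G ε z k < ENNReal.ofReal t ∧
        ¬collisionInstant G ε z (k + 1) < ENNReal.ofReal t) ∨
        (k = 0 ∧ ∀ m, collisionInstant G ε z m < ENNReal.ofReal t)} := by
    ext z
    simp only [mem_preimage, mem_singleton_iff, mem_setOf_eq]
    exact Nat.sSup_eq_iff_of_lowerSet (S := {m | collisionInstant G ε z m < ENNReal.ofReal t})
      (by simpa using ht) (fun m n hmn hn => (monotone_collisionInstant z hmn).trans_lt hn) k
  rw [hset]
  refine measurableSet_setOf.2 ((((measurableSet_setOf.1 (hA k)).and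
    (measurableSet_setOf.1 (hA (k + 1))).not)).or (measurable_const.and
      (Measurable.forall fun m => measurableSet_setOf.1 (hA m))))

/-- **Each forward flow map is measurable.** [folklore] -/
theorem measurable_fwdFlow (hG : G.IsHardSphereRegular ε) (hGm : G.IsMeasurable) (t : ℝ) :
    Measurable fun z : Config N d X => fwdFlow G ε z t := by
  have hF : Measurable fun p : ℕ × Config N d X =>
      freeFlight G (t - (collisionInstant G ε p.2 p.1).toReal) (stateAfter G ε p.2 p.1) :=
    measurable_from_prod_countable_right fun k => hGm.measurable_freeFlight₂.comp
      ((measurable_const.sub (measurable_collisionInstant hG hGm k).ennreal_toReal).prodMk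
        (measurable_stateAfter hG hGm k))
  unfold fwdFlow
  exact hF.comp ((measurable_collisionCount hG hGm t).prodMk measurable_id)

/-- **Each left-continuous forward flow map is measurable.** [folklore] -/
theorem measurable_fwdFlowLeft (hG : G.IsHardSphereRegular ε) (hGm : G.IsMeasurable) (t : ℝ) :
    Measurable fun z : Config N d X => fwdFlowLeft G ε z t := by
  have hF : Measurable fun p : ℕ × Config N d X =>
      freeFlight G (t - (collisionInstant G ε p.2 p.1).toReal) (stateAfter G ε p.2 p.1) :=
    measurable_from_prod_countable_right fun k => hGm.measurable_freeFlight₂.comp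
      ((measurable_const.sub (measurable_collisionInstant hG hGm k).ennreal_toReal).prodMk
        (measurable_stateAfter hG hGm k))
  unfold fwdFlowLeft
  exact hF.comp ((measurable_collisionCountBefore hG hGm t).prodMk measurable_id)

/-- **Each time-`t` map of the two-sided flow is measurable.** [folklore] -/
theorem measurable_flow (hG : G.IsHardSphereRegular ε) (hGm : G.IsMeasurable) (t : ℝ) :
    Measurable (flow (N := N) G ε t) := by
  by_cases ht : 0 ≤ t
  · have h : flow (N := N) G ε t = fun z => fwdFlow G ε z t := funext fun z => flow_of_nonneg ht z
    rw [h]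
    exact measurable_fwdFlow hG hGm t
  · have h : flow (N := N) G ε t = fun z => flipVel (fwdFlowLeft G ε (flipVel z) (-t)) :=
      funext fun z => flow_of_neg (not_le.1 ht) z
    rw [h]
    exact measurable_flipVel.comp ((measurable_fwdFlowLeft hG hGm (-t)).comp measurable_flipVel)

end Flow

/-! ## Measurability of the good set -/

/-- The set of simple incoming collision configurations is measurable. [folklore] -/
theorem measurableSet_isSimpleIncoming (hGm : G.IsMeasurable) :
    MeasurableSet {z : Config N d X | IsSimpleIncoming G ε z} := by
  refine measurableSet_setOf.2 (Measurable.exists fun p => measurable_const.and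
    ((measurableSet_setOf.1 (hGm.measurableSet_isIncoming p.1 p.2)).and
      (Measurable.forall fun i => Measurable.forall fun j => measurable_const.imp
        ((measurableSet_setOf.1 ?_).iff measurable_const))))
  exact measurableSet_contactSet G hGm.measurable_sepVec N ε i j

section NoTouch

variable [TopologicalSpace X]

/-- **No grazing touch inside the first free flight is a measurable condition.** The set of
`w` whose free flight meets no contact strictly between time `0` and the exit time is
measurable: its complement is the countable union over rational windows `[a, b] ⊂ (0, τ(w))`
and pairs `(i, j)` of the events "the pair distance along the flight comes within `1/(n+1)`
of `ε` at rational times of `(a, b)` for every `n`", by compactness of `[a, b]` and continuity of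
the flight (a contact time inside the domain is a minimum `= ε` of the pair distance). [folklore] -/
theorem measurableSet_noTouch (hG : G.IsHardSphereRegular ε) (hGm : G.IsMeasurable) :
    MeasurableSet {w : Config N d X | ∀ t : ℝ, 0 < t → ENNReal.ofReal t < freeExitTime G ε w →
      ∀ i j : Fin N, i ≠ j → freeFlight G t w ∉ contactSet G N ε i j} := by
  -- the pair distance along the flight
  set f : ℚ → Fin N → Fin N → Config N d X → ℝ :=
    fun q i j w => ‖G.sepVec (freeFlight G q w i).1 (freeFlight G q w j).1‖ with hf
  have hfm : ∀ q i j, Measurable (f q i j) := fun q i j =>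
    (hGm.measurable_sepVec_config i j).comp (hGm.measurable_freeFlight q) |>.norm
  -- the bad set
  set B : Set (Config N d X) := {w | ∃ a : ℚ, ∃ b : ℚ, ∃ i : Fin N, ∃ j : Fin N,
    (0 : ℝ) < a ∧ i ≠ j ∧ ENNReal.ofReal b < freeExitTime G ε w ∧
      ∀ n : ℕ, ∃ q : ℚ, (a : ℝ) < q ∧ (q : ℝ) < b ∧ f q i j w < ε + 1 / (n + 1)} with hB
  have hBm : MeasurableSet B := by
    refine measurableSet_setOf.2 (Measurable.exists fun a => Measurable.exists fun b =>
      Measurable.exists fun i => Measurable.exists fun j => measurable_const.and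
        (measurable_const.and ((measurableSet_setOf.1 (measurableSet_lt measurable_const
          (measurable_freeExitTime hG hGm))).and (Measurable.forall fun n =>
            Measurable.exists fun q => measurable_const.and (measurable_const.and
              (measurableSet_setOf.1 (measurableSet_lt (hfm q i j) measurable_const)))))))
  suffices heq : {w : Config N d X | ∀ t : ℝ, 0 < t → ENNReal.ofReal t < freeExitTime G ε w →
      ∀ i j : Fin N, i ≠ j → freeFlight G t w ∉ contactSet G N ε i j} = Bᶜ by
    rw [heq]
    exact hBm.compl
  ext w
  simp only [mem_setOf_eq, mem_compl_iff]
  constructor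
  · -- no touch ⇒ not bad: a bad window produces a touch by compactness
    rintro hgood ⟨a, b, i, j, ha, hij, hb, hn⟩
    choose q hq using hn
    obtain ⟨t, ht, φ, hφ, hlim⟩ := isCompact_Icc.tendsto_subseq (x := fun n => (q n : ℝ))
      (s := Icc (a : ℝ) b) fun n => ⟨(hq n).1.le, (hq n).2.1.le⟩
    -- continuity of the pair distance along the flight
    have hcont : Continuous fun s : ℝ =>
        ‖G.sepVec (freeFlight G s w i).1 (freeFlight G s w j).1‖ := by
      simpa only [Function.comp_def] using
        (hG.continuous_norm_sepVec_config i j).comp (hG.continuous_freeFlight w)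
    have hle : ‖G.sepVec (freeFlight G t w i).1 (freeFlight G t w j).1‖ ≤ ε := by
      have hlim' := (hcont.tendsto t).comp hlim
      refine le_of_forall_pos_lt_add fun δ hδ => ?_
      obtain ⟨m, hm⟩ := exists_nat_one_div_lt hδ
      have hev : ∀ᶠ n in atTop, ‖G.sepVec (freeFlight G (q (φ n)) w i).1
          (freeFlight G (q (φ n)) w j).1‖ < ε + 1 / (m + 1) := by
        refine (eventually_ge_atTop m).mono fun n hn => ?_
        refine (hq (φ n)).2.2.trans_le ?_
        have hφn : (m : ℝ) + 1 ≤ (φ n : ℝ) + 1 := by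
          exact_mod_cast Nat.succ_le_succ (hn.trans (hφ.id_le n))
        gcongr
      have := le_of_tendsto hlim' (hev.mono fun n hn => hn.le)
      linarith
    have htmem : freeFlight G t w ∈ hardSphereDomain G N ε := by
      refine freeFlight_mem_hardSphereDomain_of_lt (ha.le.trans ht.1) (lt_of_le_of_lt ?_ hb)
      exact ENNReal.ofReal_le_ofReal ht.2
    have hc : freeFlight G t w ∈ contactSet G N ε i j :=
      ⟨htmem, le_antisymm hle (htmem i j hij)⟩
    exact hgood t (ha.trans_le ht.1) ((ENNReal.ofReal_le_ofReal ht.2).trans_lt hb) i j hij hc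
  · -- not bad ⇒ no touch: a touch produces a bad window by continuity
    intro hnot t ht0 htτ i j hij hc
    refine hnot ?_
    obtain ⟨a, ha0, hat⟩ := exists_rat_btwn (half_pos ht0)
    obtain ⟨b, -, htb, hbτ⟩ := ENNReal.lt_iff_exists_rat_btwn.1 htτ
    change ENNReal.ofReal t < ENNReal.ofReal b at htb
    change ENNReal.ofReal b < freeExitTime G ε w at hbτ
    have htb' : t < b := (ENNReal.ofReal_lt_ofReal_iff_of_nonneg ht0.le).1 htb
    refine ⟨a, b, i, j, by linarith, hij, hbτ, fun n => ?_⟩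
    have hcont : Continuous fun s : ℝ =>
        ‖G.sepVec (freeFlight G s w i).1 (freeFlight G s w j).1‖ := by
      simpa only [Function.comp_def] using
        (hG.continuous_norm_sepVec_config i j).comp (hG.continuous_freeFlight w)
    have hev : ∀ᶠ s : ℝ in 𝓝 t, ‖G.sepVec (freeFlight G s w i).1 (freeFlight G s w j).1‖ <
        ε + 1 / (n + 1) ∧ (a : ℝ) < s ∧ s < b := by
      refine ((hcont.tendsto t).eventually (gt_mem_nhds ?_)).and
        ((lt_mem_nhds (by linarith)).and (gt_mem_nhds htb'))
      rw [hc.2]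
      exact lt_add_of_pos_right ε (by positivity)
    obtain ⟨η, hη, hball⟩ := Metric.eventually_nhds_iff.1 hev
    obtain ⟨q, htq, hqη⟩ := exists_rat_btwn (lt_add_of_pos_right t hη)
    have hdist : dist (q : ℝ) t < η := by
      rw [Real.dist_eq, abs_lt]
      constructor <;> linarith
    obtain ⟨h1, h2, h3⟩ := hball hdist
    exact ⟨q, h2, h3, h1⟩

end NoTouch

section Good

variable [TopologicalSpace X]

/-- **The set of forward-good data is measurable.** [folklore] -/
theorem measurableSet_fwdGood (hG : G.IsHardSphereRegular ε) (hGm : G.IsMeasurable) :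
    MeasurableSet {z : Config N d X | FwdGood G ε z} := by
  have hτ := measurable_freeExitTime (N := N) hG hGm
  have hst := measurable_stateAfter (N := N) hG hGm
  have hexit : ∀ k, Measurable fun z : Config N d X =>
      freeFlight G (freeExitTime G ε (stateAfter G ε z k)).toReal (stateAfter G ε z k) := fun k =>
    hGm.measurable_freeFlight₂.comp (((hτ.comp (hst k)).ennreal_toReal).prodMk (hst k))
  refine measurableSet_setOf.2 ((Measurable.forall fun k => ?_).and
    ((Measurable.forall fun k => ?_).and ?_))
  · exact (measurableSet_setOf.1 ((hτ.comp (hst k)) (measurableSet_singleton ∞))).not.imp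
      (measurableSet_setOf.1 ((measurableSet_isSimpleIncoming hGm).preimage (hexit k)))
  · exact measurableSet_setOf.1 ((measurableSet_noTouch hG hGm).preimage (hst k))
  · have hsum : Measurable fun z : Config N d X =>
        ∑' k, freeExitTime G ε (stateAfter G ε z k) := by
      simp_rw [ENNReal.tsum_eq_iSup_sum]
      exact Measurable.iSup fun s => Finset.measurable_fun_sum s fun k _ => hτ.comp (hst k)
    exact measurableSet_setOf.1 (hsum (measurableSet_singleton ∞))

/-- **The good set `Γ₀` is measurable** (regular and measurable geometry). [folklore] -/
theorem measurableSet_good (hG : G.IsHardSphereRegular ε) (hGm : G.IsMeasurable) :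
    MeasurableSet (good (N := N) G ε) := by
  have hc : ∀ i j : Fin N, MeasurableSet (contactSet G N ε i j) := fun i j =>
    measurableSet_contactSet G hGm.measurable_sepVec N ε i j
  refine (measurableSet_hardSphereDomain G hGm.measurable_sepVec N ε).inter
    (MeasurableSet.inter ?_ ((measurableSet_fwdGood hG hGm).inter
      ((measurableSet_fwdGood hG hGm).preimage measurable_flipVel)))
  refine measurableSet_setOf.2 (Measurable.forall fun i => Measurable.forall fun j =>
    measurable_const.imp ((measurableSet_setOf.1 (hc i j)).imp
      ((measurableSet_setOf.1 (hGm.measurableSet_isOutgoing i j)).and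
        (Measurable.forall fun i' => Measurable.forall fun j' => measurable_const.imp
          ((measurableSet_setOf.1 (hc i' j')).imp measurable_const)))))

end Good

/-- **Discharge of `torusFlow_measurable`**: on the flat torus with `0 < ε < 1/2` the good set
of the constructed flow is measurable and each `T^t` is a measurable self-map of the phase
space. [folklore] -/
theorem torusFlow_measurable_holds : torusFlow_measurable (d := d) := by
  intro ε _hε hε' N
  have hG := Torus.isHardSphereRegular_geometry (d := d) hε'
  have hGm := Torus.isMeasurable_geometry (d := d)
  exact ⟨measurableSet_good hG hGm, fun t => measurable_flow hG hGm t⟩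

end Alexander

end Kinetic

end

end Literature.Analysis.FluidPDE
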